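import Summits.KontsevichZagierPeriods.KontsevichZagierPeriods.Theorems.MzvKernelInKZTwoPosetsDefs
import Summits.KontsevichZagierPeriods.KontsevichZagierPeriods.Theorems.MzvKernelInKZTwoPosetsInteriorLandenAux2

/-!
# `MzvKernelInKZ` (stmt-KontsevichZagierPeriods-3914), line two-posets-interior-landen: stub `stub_interiorLanden`

The **interior Landen identity `E′` with spectators is a chain of moves of the Kontsevich–Zagier
calculus** (registered stub `stub_interiorLanden : InteriorLanden` of the skeleton
`MzvKernelInKZ_of`). On `(0,1)^{m+2}` with coordinates `v = x 0`, spectators `p_i = x (i+1)`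
(`i < m`, `m ≥ 1`), `r = x (m+1)` and modulus `y = p₁⋯p_m ∈ (0,1)`, any representation `r₁` of
`L = [cube, v/((1-yv)(1-vr))]` is KZ-equivalent to any representation `r₂` of
`R = [cube, 1/((1-yv)(1-yvr))]` (both fibres equal `y⁻¹(Li₂ y + ½ log²(1-y))`: Landen's
functional equation of the dilogarithm at the interior modulus `y`). The chain uses only rule (2)
(change of variables, with exactly the hypotheses of `KZ.changeOfVariablesRel`) and rule (1b)
(integrand additivity); every intermediate is an absolutely convergent positive rational
representation:

1. `s = r/v` (`Φ₁`): `[D_A, A] − [r₁]`, `D_A = {r < v}`, `A = 1/((1-yv)(1-r))` (`move1`);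
2. the fibrewise Möbius involution `φ_y(t) = (1-t)/(1-yt)` on both fibre coordinates (`Φ₂`):
   `[D_A, A] − [D_B, B]`, `D_B = {v < r}`, `B = 1/((1-yv) r (1-yr))` (`move2`);
3. `1/(r(1-yr)) = 1/r + y/(1-yr)`: `[B] − [B₁] − [B₂]` (`move35`);
4. `ρ = v r` (`Φ₄`): `[r₂] − [D_A, C']`, `C' = 1/(v(1-yv)(1-yr))` (`move4`), then the swap of
   the two fibre coordinates (a coordinate permutation is a move,
   `KZ.of_sub_of_reindex_mem_relations`), after which `C'` becomes `B` on `D_B`;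
5. the same partial fraction splits the swapped `C'` into the same `[B₁] + [B₂]` (`move35`).

Integrability of the intermediates is transported from `r₁`, `r₂` along the substitutions by
`MeasureTheory.integrableOn_image_iff_integrableOn_abs_det_fderiv_smul` and to the pieces by
domination; maps, Jacobians, domains and integrands are in the two tools files (no definitions:
file-local notation only).

References: M. Kontsevich, D. Zagier, *Periods* (2001), §1.2 rules (1), (2); M. Kaneko,
S. Yamamoto, *A new integral–series identity of multiple zeta values and regularizations*,
Selecta Math. 24 (2018), §4 (2-posets and the Landen connector).
-/

noncomputable section

namespace Summit.KontsevichZagierPeriods.MzvKernelInKZ.TwoPosets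

open Set MeasureTheory
open Literature.NumberTheory.Transcendental

/-- `φ_y(t) = (1 - t) / (1 - y t)`. -/
local notation "φ⟪" y ", " t "⟫" => (1 - t) / (1 - y * t)

/-- The modulus `y = p₁ ⋯ p_m`. -/
local notation "ymod⟪" m ", " x "⟫" => ∏ i : Fin m, x (Fin.castSucc (Fin.succ i))

set_option quotPrecheck false in
/-- The open cube `(0,1)^{m+2}` (the line's `cube (m + 2)`). -/
local notation "cub⟪" m "⟫" => {x : Fin (m + 2) → ℝ | ∀ i, 0 < x i ∧ x i < 1}

set_option quotPrecheck false in
/-- `D_A = {x ∈ (0,1)^{m+2} | r < v}`. -/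
local notation "DA⟪" m "⟫" =>
  {x : Fin (m + 2) → ℝ | (∀ i, 0 < x i ∧ x i < 1) ∧ x (Fin.last (m + 1)) < x 0}

set_option quotPrecheck false in
/-- `D_B = {x ∈ (0,1)^{m+2} | v < r}`. -/
local notation "DB⟪" m "⟫" =>
  {x : Fin (m + 2) → ℝ | (∀ i, 0 < x i ∧ x i < 1) ∧ x 0 < x (Fin.last (m + 1))}

/-- The move-1 map `Φ₁ (v, p, r) = (v, p, r/v)`. -/
local notation "Φ₁⟪" m "⟫" => fun x : Fin (m + 2) → ℝ =>
  Function.update x (Fin.last (m + 1)) (x (Fin.last (m + 1)) / x 0)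

/-- The move-4 map `Φ₄ (v, p, r) = (v, p, v r)`. -/
local notation "Φ₄⟪" m "⟫" => fun x : Fin (m + 2) → ℝ =>
  Function.update x (Fin.last (m + 1)) (x 0 * x (Fin.last (m + 1)))

/-- The move-2 map, the fibrewise Möbius involution `Φ₂ (v, p, r) = (φ_y v, p, φ_y r)`. -/
local notation "Φ₂⟪" m "⟫" => fun x : Fin (m + 2) → ℝ =>
  Function.update (Function.update x 0 φ⟪ymod⟪m, x⟫, x 0⟫) (Fin.last (m + 1))
    φ⟪ymod⟪m, x⟫, x (Fin.last (m + 1))⟫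

/-- The swap of the two fibre coordinates. -/
local notation "swp⟪" m "⟫" => Equiv.swap (0 : Fin (m + 2)) (Fin.last (m + 1))

/-- `L = v / ((1 - y v)(1 - v r))` (the line's `landenLeft m`, definitionally). -/
local notation "fL⟪" m ", " x "⟫" =>
  x 0 / ((1 - ymod⟪m, x⟫ * x 0) * (1 - x 0 * x (Fin.last (m + 1))))

/-- `R = 1 / ((1 - y v)(1 - y v r))` (the line's `landenRight m`, definitionally). -/
local notation "fR⟪" m ", " x "⟫" =>
  1 / ((1 - ymod⟪m, x⟫ * x 0) * (1 - ymod⟪m, x⟫ * x 0 * x (Fin.last (m + 1))))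

/-- `A = 1 / ((1 - y v)(1 - r))`. -/
local notation "fa⟪" m ", " x "⟫" => 1 / ((1 - ymod⟪m, x⟫ * x 0) * (1 - x (Fin.last (m + 1))))

/-- `B = 1 / ((1 - y v) r (1 - y r))`. -/
local notation "fb⟪" m ", " x "⟫" =>
  1 / ((1 - ymod⟪m, x⟫ * x 0) * x (Fin.last (m + 1)) * (1 - ymod⟪m, x⟫ * x (Fin.last (m + 1))))

/-- `B₁ = C₁ = 1 / ((1 - y v) r)`. -/
local notation "fb1⟪" m ", " x "⟫" => 1 / ((1 - ymod⟪m, x⟫ * x 0) * x (Fin.last (m + 1)))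

/-- `B₂ = C₂ = y / ((1 - y v)(1 - y r))`. -/
local notation "fb2⟪" m ", " x "⟫" =>
  ymod⟪m, x⟫ / ((1 - ymod⟪m, x⟫ * x 0) * (1 - ymod⟪m, x⟫ * x (Fin.last (m + 1))))

/-- `C' = 1 / (v (1 - y v)(1 - y r))`. -/
local notation "fc⟪" m ", " x "⟫" =>
  1 / (x 0 * (1 - ymod⟪m, x⟫ * x 0) * (1 - ymod⟪m, x⟫ * x (Fin.last (m + 1))))

namespace Landen

variable {m : ℕ}

/-! ### The pointwise identities behind the moves -/

/-- Move 1: `A = (L ∘ Φ₁) · |det Φ₁'|` on `D_A`. -/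
theorem fa_eq_fL_Phi1 (hm : 1 ≤ m) {x : Fin (m + 2) → ℝ} (hx : x ∈ DA⟪m⟫) :
    fa⟪m, x⟫ = fL⟪m, Φ₁⟪m⟫ x⟫ * |1 / x 0| := by
  obtain ⟨h0, -, -, hl', -, -, h1, -⟩ := cub_facts hm hx.1
  simp only [Function.update_self, Function.update_of_ne zero_ne_last, ymod_update_last]
  rw [abs_of_pos (by positivity)]
  have : (1 : ℝ) - x (Fin.last (m + 1)) ≠ 0 := by linarith
  field_simp

/-- Move 2: `A = (B ∘ Φ₂) · |det Φ₂'|` on `D_A` (the Möbius identities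
`1 - yφ_y(t) = (1-y)/(1-yt)`). -/
theorem fa_eq_fb_Phi2 (hm : 1 ≤ m) {x : Fin (m + 2) → ℝ} (hx : x ∈ DA⟪m⟫) :
    fa⟪m, x⟫ = fb⟪m, Φ₂⟪m⟫ x⟫ * ((1 - ymod⟪m, x⟫) ^ 2 /
      ((1 - ymod⟪m, x⟫ * x 0) ^ 2 * (1 - ymod⟪m, x⟫ * x (Fin.last (m + 1))) ^ 2)) := by
  obtain ⟨h0, h0', hl, hl', hy, hy', h1, h2⟩ := cub_facts hm hx.1
  simp only [Function.update_self, Function.update_of_ne zero_ne_last, ymod_update_last,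
    ymod_update_zero]
  rw [one_sub_y_mul_phi h1.ne', one_sub_y_mul_phi h2.ne']
  have : (1 : ℝ) - x (Fin.last (m + 1)) ≠ 0 := by linarith
  have : (1 : ℝ) - ymod⟪m, x⟫ ≠ 0 := by linarith
  field_simp

/-- Moves 3 and 5: the positive partial fraction `B = B₁ + B₂` on the cube. -/
theorem fb_eq_add (hm : 1 ≤ m) {x : Fin (m + 2) → ℝ} (hx : x ∈ cub⟪m⟫) :
    fb⟪m, x⟫ = fb1⟪m, x⟫ + fb2⟪m, x⟫ := by
  obtain ⟨-, -, hl, -, -, -, h1, h2⟩ := cub_facts hm hx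
  field_simp
  ring

/-- Move 4: `R = (C' ∘ Φ₄) · |det Φ₄'|` on the cube. -/
theorem fR_eq_fc_Phi4 (hm : 1 ≤ m) {x : Fin (m + 2) → ℝ} (hx : x ∈ cub⟪m⟫) :
    fR⟪m, x⟫ = fc⟪m, Φ₄⟪m⟫ x⟫ * |x 0| := by
  obtain ⟨h0, h0', hl, hl', hy, hy', h1, h2⟩ := cub_facts hm hx
  simp only [Function.update_self, Function.update_of_ne zero_ne_last, ymod_update_last]
  rw [abs_of_pos h0]
  have : (1 : ℝ) - ymod⟪m, x⟫ * (x 0 * x (Fin.last (m + 1))) ≠ 0 := by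
    have := ymod_mul_lt_one hx (mul_pos h0 hl) (mul_lt_one_of_nonneg_of_lt_one_left h0.le h0' hl'.le)
    linarith
  field_simp

/-! ### Domination `0 ≤ B₁, B₂ ≤ B` and continuity of the pieces on the cube -/

/-- `0 ≤ B₁ ≤ B` on the cube (`0 < 1 - y r ≤ 1`). -/
theorem fb1_le_fb (hm : 1 ≤ m) {x : Fin (m + 2) → ℝ} (hx : x ∈ cub⟪m⟫) :
    0 ≤ fb1⟪m, x⟫ ∧ fb1⟪m, x⟫ ≤ fb⟪m, x⟫ := by
  obtain ⟨-, -, hl, hl', hy, hy', h1, h2⟩ := cub_facts hm hx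
  refine ⟨(div_pos one_pos (mul_pos h1 hl)).le,
    one_div_le_one_div_of_le (mul_pos (mul_pos h1 hl) h2) ?_⟩
  refine mul_le_of_le_one_right (mul_pos h1 hl).le ?_
  nlinarith

/-- `0 ≤ B₂ ≤ B` on the cube (`y r ≤ 1`). -/
theorem fb2_le_fb (hm : 1 ≤ m) {x : Fin (m + 2) → ℝ} (hx : x ∈ cub⟪m⟫) :
    0 ≤ fb2⟪m, x⟫ ∧ fb2⟪m, x⟫ ≤ fb⟪m, x⟫ := by
  obtain ⟨-, -, hl, hl', hy, hy', h1, h2⟩ := cub_facts hm hx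
  refine ⟨(div_pos hy (mul_pos h1 h2)).le, ?_⟩
  rw [div_le_div_iff₀ (mul_pos h1 h2) (mul_pos (mul_pos h1 hl) h2)]
  have hle : ymod⟪m, x⟫ * x (Fin.last (m + 1)) ≤ 1 := (ymod_mul_lt_one hx hl hl').le
  have hP : 0 ≤ (1 - ymod⟪m, x⟫ * x 0) * (1 - ymod⟪m, x⟫ * x (Fin.last (m + 1))) :=
    (mul_pos h1 h2).le
  nlinarith [mul_le_mul_of_nonneg_left hle hP]

/-- The modulus is continuous. -/
theorem continuous_ymod : Continuous (fun x : Fin (m + 2) → ℝ => ymod⟪m, x⟫) :=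
  continuous_finsetProd _ fun i _ => continuous_apply (Fin.castSucc (Fin.succ i))

/-- `B₁` is continuous on the cube. -/
theorem continuousOn_fb1 (hm : 1 ≤ m) : ContinuousOn (fun x => fb1⟪m, x⟫) cub⟪m⟫ := by
  refine continuous_const.continuousOn.div ?_ fun x hx => ?_
  · exact ((continuous_const.sub (continuous_ymod.mul (continuous_apply 0))).mul
      (continuous_apply _)).continuousOn
  · obtain ⟨-, -, hl, -, -, -, h1, -⟩ := cub_facts hm hx
    exact mul_ne_zero h1.ne' hl.ne'

/-- `B₂` is continuous on the cube. -/
theorem continuousOn_fb2 (hm : 1 ≤ m) : ContinuousOn (fun x => fb2⟪m, x⟫) cub⟪m⟫ := by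
  refine continuous_ymod.continuousOn.div ?_ fun x hx => ?_
  · exact ((continuous_const.sub (continuous_ymod.mul (continuous_apply 0))).mul
      (continuous_const.sub (continuous_ymod.mul (continuous_apply _)))).continuousOn
  · obtain ⟨-, -, -, -, -, -, h1, h2⟩ := cub_facts hm hx
    exact mul_ne_zero h1.ne' h2.ne'

/-! ### Integrability of the intermediates (transport and domination) -/

/-- Integrability of `A` on `D_A`, transported from a representation of `L` on the cube along
`Φ₁` (`MeasureTheory.integrableOn_image_iff_integrableOn_abs_det_fderiv_smul`). -/
theorem integrableOn_fa (hm : 1 ≤ m) (r₁ : KZ.IntegralRep (m + 2)) (hd₁ : r₁.domain = cub⟪m⟫)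
    (hi₁ : EqOn r₁.integrand (fun x => fL⟪m, x⟫) cub⟪m⟫) :
    IntegrableOn (fun x => fa⟪m, x⟫) DA⟪m⟫ volume := by
  obtain ⟨D, hD⟩ := hasFDerivAt_Phi1 (m := m)
  have h1 : IntegrableOn r₁.integrand (Φ₁⟪m⟫ '' DA⟪m⟫) volume := by
    rw [image_Phi1, ← hd₁]; exact r₁.integrableOn
  have h2 := (integrableOn_image_iff_integrableOn_abs_det_fderiv_smul volume measurableSet_DA
    (fun x hx => (hD x (hx.1 0).1.ne').1.hasFDerivWithinAt) injOn_Phi1 r₁.integrand).mp h1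
  refine h2.congr_fun (fun x hx => ?_) measurableSet_DA
  dsimp only
  rw [(hD x (hx.1 0).1.ne').2, hi₁ (Phi1_mem_cub hx), smul_eq_mul, mul_comm]
  exact (fa_eq_fL_Phi1 hm hx).symm

/-- Integrability of `B` on `D_B`, transported from `A` along the involution `Φ₂`. -/
theorem integrableOn_fb (hm : 1 ≤ m) (hA : IntegrableOn (fun x => fa⟪m, x⟫) DA⟪m⟫ volume) :
    IntegrableOn (fun x => fb⟪m, x⟫) DB⟪m⟫ volume := by
  obtain ⟨D, hD⟩ := hasFDerivAt_Phi2 (m := m) hm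
  rw [← image_Phi2 hm]
  refine (integrableOn_image_iff_integrableOn_abs_det_fderiv_smul volume measurableSet_DA
    (fun x hx => (hD x hx.1).1.hasFDerivWithinAt) (injOn_Phi2 hm) _).mpr ?_
  refine hA.congr_fun (fun x hx => ?_) measurableSet_DA
  rw [(hD x hx.1).2, smul_eq_mul, mul_comm]
  exact fa_eq_fb_Phi2 hm hx

/-- Integrability of `B₁` and `B₂` on `D_B` by domination. -/
theorem integrableOn_fb12 (hm : 1 ≤ m) (hB : IntegrableOn (fun x => fb⟪m, x⟫) DB⟪m⟫ volume) :
    IntegrableOn (fun x => fb1⟪m, x⟫) DB⟪m⟫ volume ∧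
      IntegrableOn (fun x => fb2⟪m, x⟫) DB⟪m⟫ volume := by
  refine ⟨Integrable.mono' hB ?_ ?_, Integrable.mono' hB ?_ ?_⟩
  · exact ((continuousOn_fb1 hm).mono DB_subset_cub).aestronglyMeasurable measurableSet_DB
  · refine ae_restrict_of_forall_mem measurableSet_DB fun x hx => ?_
    rw [Real.norm_eq_abs, abs_of_nonneg (fb1_le_fb hm hx.1).1]
    exact (fb1_le_fb hm hx.1).2
  · exact ((continuousOn_fb2 hm).mono DB_subset_cub).aestronglyMeasurable measurableSet_DB
  · refine ae_restrict_of_forall_mem measurableSet_DB fun x hx => ?_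
    rw [Real.norm_eq_abs, abs_of_nonneg (fb2_le_fb hm hx.1).1]
    exact (fb2_le_fb hm hx.1).2

/-- Integrability of `C'` on `D_A`, transported from a representation of `R` on the cube along
`Φ₄`. -/
theorem integrableOn_fc (hm : 1 ≤ m) (r₂ : KZ.IntegralRep (m + 2)) (hd₂ : r₂.domain = cub⟪m⟫)
    (hi₂ : EqOn r₂.integrand (fun x => fR⟪m, x⟫) cub⟪m⟫) :
    IntegrableOn (fun x => fc⟪m, x⟫) DA⟪m⟫ volume := by
  obtain ⟨D, hD⟩ := hasFDerivAt_Phi4 (m := m)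
  rw [← image_Phi4]
  refine (integrableOn_image_iff_integrableOn_abs_det_fderiv_smul volume measurableSet_cub
    (fun x _ => (hD x).1.hasFDerivWithinAt) injOn_Phi4 _).mpr ?_
  have h1 : IntegrableOn r₂.integrand cub⟪m⟫ volume := hd₂ ▸ r₂.integrableOn
  refine h1.congr_fun (fun x hx => ?_) measurableSet_cub
  rw [(hD x).2, hi₂ hx, smul_eq_mul, mul_comm]
  exact fR_eq_fc_Phi4 hm hx

/-! ### The moves -/

/-- **Move 1** (Kontsevich–Zagier's rule (2) along `s = r/v`): `[D_A, A] − [r₁] ∈ relations`. -/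
theorem move1 (hm : 1 ≤ m) (A r₁ : KZ.IntegralRep (m + 2)) (hdA : A.domain = DA⟪m⟫)
    (hiA : A.integrand = fun x => fa⟪m, x⟫) (hd₁ : r₁.domain = cub⟪m⟫)
    (hi₁ : EqOn r₁.integrand (fun x => fL⟪m, x⟫) cub⟪m⟫) :
    KZ.of A - KZ.of r₁ ∈ KZ.relations := by
  obtain ⟨D, hD⟩ := hasFDerivAt_Phi1 (m := m)
  refine KZ.changeOfVariablesRel_subset_relations ⟨m + 2, A, r₁, Φ₁⟪m⟫, D, ?_, fun x hx => ?_,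
    ?_, ?_, fun x hx => ?_, rfl⟩
  · rw [hdA]; exact isSemialgebraicMapOn_Phi1
  · rw [hdA] at hx ⊢; exact (hD x (hx.1 0).1.ne').1.hasFDerivWithinAt
  · rw [hdA]; exact injOn_Phi1
  · rw [hdA, hd₁]; exact image_Phi1.symm
  · rw [hdA] at hx
    rw [hiA, (hD x (hx.1 0).1.ne').2, hi₁ (Phi1_mem_cub hx)]
    exact fa_eq_fL_Phi1 hm hx

/-- **Move 2** (rule (2) along the fibrewise Möbius involution): `[D_A, A] − [D_B, B] ∈ relations`. -/
theorem move2 (hm : 1 ≤ m) (A B : KZ.IntegralRep (m + 2)) (hdA : A.domain = DA⟪m⟫)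
    (hiA : A.integrand = fun x => fa⟪m, x⟫) (hdB : B.domain = DB⟪m⟫)
    (hiB : B.integrand = fun x => fb⟪m, x⟫) : KZ.of A - KZ.of B ∈ KZ.relations := by
  obtain ⟨D, hD⟩ := hasFDerivAt_Phi2 (m := m) hm
  refine KZ.changeOfVariablesRel_subset_relations ⟨m + 2, A, B, Φ₂⟪m⟫, D, ?_, fun x hx => ?_,
    ?_, ?_, fun x hx => ?_, rfl⟩
  · rw [hdA]; exact isSemialgebraicMapOn_Phi2 hm
  · rw [hdA] at hx ⊢; exact (hD x hx.1).1.hasFDerivWithinAt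
  · rw [hdA]; exact injOn_Phi2 hm
  · rw [hdA, hdB]; exact (image_Phi2 hm).symm
  · rw [hdA] at hx
    rw [hiA, hiB, (hD x hx.1).2]
    exact fa_eq_fb_Phi2 hm hx

/-- **Moves 3 and 5** (rule (1b)): a representation with domain `D_B` whose integrand is `B` on
`D_B` differs from `[D_B, B₁] + [D_B, B₂]` by ONE integrand-additivity move. -/
theorem move35 (hm : 1 ≤ m) (B B₁ B₂ : KZ.IntegralRep (m + 2)) (hdB : B.domain = DB⟪m⟫)
    (hiB : EqOn B.integrand (fun x => fb⟪m, x⟫) DB⟪m⟫) (hd₁ : B₁.domain = DB⟪m⟫)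
    (hi₁ : B₁.integrand = fun x => fb1⟪m, x⟫) (hd₂ : B₂.domain = DB⟪m⟫)
    (hi₂ : B₂.integrand = fun x => fb2⟪m, x⟫) :
    KZ.of B - KZ.of B₁ - KZ.of B₂ ∈ KZ.relations := by
  refine KZ.integrandAddRel_subset_relations ⟨m + 2, B, B₁, B₂, by rw [hd₁, hdB],
    by rw [hd₂, hdB], fun x hx => ?_, rfl⟩
  rw [hdB] at hx
  rw [hiB hx, Pi.add_apply, hi₁, hi₂]
  exact fb_eq_add hm hx.1

/-- **Move 4** (rule (2) along `ρ = v r`): `[r₂] − [D_A, C'] ∈ relations`. -/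
theorem move4 (hm : 1 ≤ m) (r₂ C : KZ.IntegralRep (m + 2)) (hd₂ : r₂.domain = cub⟪m⟫)
    (hi₂ : EqOn r₂.integrand (fun x => fR⟪m, x⟫) cub⟪m⟫) (hdC : C.domain = DA⟪m⟫)
    (hiC : C.integrand = fun x => fc⟪m, x⟫) : KZ.of r₂ - KZ.of C ∈ KZ.relations := by
  obtain ⟨D, hD⟩ := hasFDerivAt_Phi4 (m := m)
  refine KZ.changeOfVariablesRel_subset_relations ⟨m + 2, r₂, C, Φ₄⟪m⟫, D, ?_,
    fun x _ => (hD x).1.hasFDerivWithinAt, ?_, ?_, fun x hx => ?_, rfl⟩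
  · rw [hd₂]; exact isSemialgebraicMapOn_Phi4
  · rw [hd₂]; exact injOn_Phi4
  · rw [hd₂, hdC]; exact image_Phi4.symm
  · rw [hd₂] at hx
    rw [hiC, (hD x).2, hi₂ hx]
    exact fR_eq_fc_Phi4 hm hx

/-- After the swap of the fibre coordinates (one move, `KZ.of_sub_of_reindex_mem_relations`), the
representation `[D_A, C']` has domain `D_B`. -/
theorem reindex_domain (C : KZ.IntegralRep (m + 2)) (hdC : C.domain = DA⟪m⟫) :
    (C.reindex swp⟪m⟫).domain = DB⟪m⟫ := by
  ext w
  rw [KZ.IntegralRep.reindex_domain, hdC]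
  simp only [mem_setOf_eq, Equiv.swap_apply_left, Equiv.swap_apply_right]
  refine and_congr ⟨fun h j => ?_, fun h i => h _⟩ Iff.rfl
  simpa using h (swp⟪m⟫ j)

/-- After the swap, the integrand of `[D_A, C']` is `B`. -/
theorem reindex_integrand (C : KZ.IntegralRep (m + 2)) (hiC : C.integrand = fun x => fc⟪m, x⟫) :
    (C.reindex swp⟪m⟫).integrand = fun w => fb⟪m, w⟫ := by
  funext w
  rw [KZ.IntegralRep.reindex_integrand, hiC]
  exact fc_swp w

end Landen

/-! ### The chain -/

open Landen in
/-- **Registered stub `stub_interiorLanden`.** The interior Landen identity `E′` with `m ≥ 1`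
spectators is a chain of moves of the Kontsevich–Zagier calculus: any representation of
`[(0,1)^{m+2}, v/((1-yv)(1-vr))]` is KZ-equivalent to any representation of
`[(0,1)^{m+2}, 1/((1-yv)(1-yvr))]`, `y = p₁⋯p_m`, through six elementary moves (`move1`, `move2`,
`move35` twice, `move4` and a coordinate swap; rules (2) and (1b) only). -/
theorem stub_interiorLanden : InteriorLanden := by
  intro m hm r₁ r₂ hd₁ hi₁ hd₂ hi₂
  have hA := integrableOn_fa hm r₁ hd₁ hi₁
  have hB := integrableOn_fb hm hA
  obtain ⟨hB1, hB2⟩ := integrableOn_fb12 hm hB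
  have hC := integrableOn_fc hm r₂ hd₂ hi₂
  obtain ⟨A, hdA, hiA⟩ := exists_rep _ _ isSemialgebraic_DA
    (sa_fa hm isSemialgebraic_DA DA_subset_cub) hA
  obtain ⟨B, hdB, hiB⟩ := exists_rep _ _ isSemialgebraic_DB
    (sa_fb hm isSemialgebraic_DB DB_subset_cub) hB
  obtain ⟨B₁, hdB₁, hiB₁⟩ := exists_rep _ _ isSemialgebraic_DB
    (sa_fb1 hm isSemialgebraic_DB DB_subset_cub) hB1
  obtain ⟨B₂, hdB₂, hiB₂⟩ := exists_rep _ _ isSemialgebraic_DB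
    (sa_fb2 hm isSemialgebraic_DB DB_subset_cub) hB2
  obtain ⟨C, hdC, hiC⟩ := exists_rep _ _ isSemialgebraic_DA
    (sa_fc hm isSemialgebraic_DA DA_subset_cub) hC
  have M1 := move1 hm A r₁ hdA hiA hd₁ hi₁
  have M2 := move2 hm A B hdA hiA hdB hiB
  have M3 := move35 hm B B₁ B₂ hdB (fun x _ => by rw [hiB]) hdB₁ hiB₁ hdB₂ hiB₂
  have M4 := move4 hm r₂ C hd₂ hi₂ hdC hiC
  have M4b : KZ.of C - KZ.of (C.reindex swp⟪m⟫) ∈ KZ.relations :=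
    KZ.of_sub_of_reindex_mem_relations _ _
  have M5 := move35 hm (C.reindex swp⟪m⟫) B₁ B₂ (reindex_domain C hdC)
    (fun x _ => by rw [reindex_integrand C hiC]) hdB₁ hiB₁ hdB₂ hiB₂
  have key : KZ.of r₁ - KZ.of r₂ =
      -(KZ.of A - KZ.of r₁) + (KZ.of A - KZ.of B) + (KZ.of B - KZ.of B₁ - KZ.of B₂) -
      (KZ.of (C.reindex swp⟪m⟫) - KZ.of B₁ - KZ.of B₂) - (KZ.of C - KZ.of (C.reindex swp⟪m⟫)) -
      (KZ.of r₂ - KZ.of C) := by abel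
  rw [KZ.Equivalent, key]
  exact sub_mem (sub_mem (sub_mem (add_mem (add_mem (neg_mem M1) M2) M3) M5) M4b) M4

end Summit.KontsevichZagierPeriods.MzvKernelInKZ.TwoPosets
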